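import Summits.QuantumFields.YangMills.Theorems.LuscherReductionDressedRitzPolyakovLiftTransplantForms
import HarnessLib

/-!
# Route `LuscherReduction`, item `DressedRitz` (stmt-QuantumFields-20205), line «polyakovlift» r7 — the (Q)-block trial states of `PScal.pscaling_core`
# from the one-site quasimode package at TWO radii (helper lemmas `--supports stmt-QuantumFields-20205`; seat ym-infvol-p2 g8 for the LEAD's WAVE 3)

`PScal.pscaling_core` (p571951) consumes a trial system `Ψ_j(U) = χ_{ρ_j}(gnCoord μ U)·F_j(gnCoord μ U)` with level-dependent radii `ρ_j ∈ [R, R_v]`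
(`ρ_0 = R_v` the vacuum radius, `ρ_j = R` for `j ≥ 1`) and asks for: physicality, `0 < ⟨Ψ_j,Ψ_j⟩`, the F6a Rayleigh floors `θ_j⟨Ψ_j,Ψ_j⟩ ≤ ⟨Ψ_j,K_BΨ_j⟩`,
and a UNIFORM relative Gram bound `|⟨Ψ_j,Ψ_{j′}⟩| ≤ ε√⟨Ψ_j,Ψ_j⟩√⟨Ψ_{j′},Ψ_{j′}⟩`.  This file derives exactly these from `TransplantForms.oneSite_package`
(p565112) for an ARBITRARY radius assignment `ρ : Fin (K+1) → [R, R_v]`: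
* `trialStates_package (hF : IsEigenFamily K F) : ∃ A Kq, …` — with the package constants `A, Kq ≥ 0` (depending on `(K, F)` only) and for all
  `B, μ, R, R_v, ρ` with `Bμ³ = 1/4`, `μ ≤ 1/8`, `π ≤ B`, `1 ≤ R ≤ ρ_j ≤ R_v ≤ 1/(8μ)`, `A e^{−R} ≤ 1/2`, `12μ²R_v² ≤ 1/2`:
  (a) `IsPhys Ψ_j`; (b) `8c·(1 − 12μ²R_v²)(1 − Ae^{−R}) ≤ ⟨Ψ_j,Ψ_j⟩ ≤ 8c` (`c = μ⁹(2π²)⁻³`), in particular `0 < ⟨Ψ_j,Ψ_j⟩`;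
  (c) `linkC B³·(1 − 2μ(E_j + A e^{−ρ_j}) − μ²Kq)·⟨Ψ_j,Ψ_j⟩ ≤ ⟨Ψ_j, K_BΨ_j⟩`;
  (d) `|⟨Ψ_j,Ψ_{j′}⟩| ≤ ε·√⟨Ψ_j,Ψ_j⟩·√⟨Ψ_{j′},Ψ_{j′}⟩` for `j ≠ j′` with the uniform `ε = (12μ²R_v² + 2Ae^{−R})/((1 − 12μ²R_v²)(1 − Ae^{−R}))`.

## WHAT THIS IS NOT
Bookkeeping toward ONE stub (`stub_pscaling`) of ONE conditional crux on the femto rung R2b1; not infinite volume, not a continuum limit, not a gap, not Clay.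
Sorry-free, no definitions, no named facts.  [cite: Luscher1983, §2–§3]
-/

set_option autoImplicit false

noncomputable section

open MeasureTheory Filter Topology Real
open scoped Matrix ENNReal
open Literature.MathematicalPhysics.QuantumFieldTheory
open Literature.MathematicalPhysics.QuantumLattice
open Literature.Analysis.OperatorTheory.YMMatrixModel

namespace Summit.QuantumFields.YangMills.Theorems.FemtoTransferGap.TransplantForms

open Summit.QuantumFields.YangMills.Theorems.FemtoTransferGap

variable {K : ℕ} {F : Fin (K + 1) → ZM → ℝ}

/-- The relative Gram bound from absolute data: `|Z| ≤ 8c·N`, `8cD ≤ X`, `8cD ≤ Y`, `0 < c`, `0 < D` ⇒ `|Z| ≤ (N/D)·√X·√Y`. [folklore] -/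
theorem abs_le_ratio_mul_sqrt_mul_sqrt {Z X Y c D N : ℝ} (hc : 0 < c) (hD : 0 < D) (hN : 0 ≤ N)
    (hZ : |Z| ≤ 8 * c * N) (hX : 8 * c * D ≤ X) (hY : 8 * c * D ≤ Y) :
    |Z| ≤ N / D * (Real.sqrt X * Real.sqrt Y) := by
  have hF0 : 0 < 8 * c * D := by positivity
  have hsqrt : 8 * c * D ≤ Real.sqrt X * Real.sqrt Y := by
    have h1 : Real.sqrt (8 * c * D) ≤ Real.sqrt X := Real.sqrt_le_sqrt hX
    have h2 : Real.sqrt (8 * c * D) ≤ Real.sqrt Y := Real.sqrt_le_sqrt hY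
    have h3 := mul_le_mul h1 h2 (Real.sqrt_nonneg _) (Real.sqrt_nonneg _)
    rwa [Real.mul_self_sqrt hF0.le] at h3
  calc |Z| ≤ 8 * c * N := hZ
    _ = N / D * (8 * c * D) := by field_simp
    _ ≤ N / D * (Real.sqrt X * Real.sqrt Y) := mul_le_mul_of_nonneg_left hsqrt (div_nonneg hN hD.le)

/-- ★★ **The (Q)-block trial states from the one-site quasimode package at two radii.**  For an AL1 family `F` (`IsEigenFamily K F`) there are the
package constants `A, Kq ≥ 0` of `oneSite_package` such that for all `B, μ > 0` with `Bμ³ = 1/4`, `μ ≤ 1/8`, `π ≤ B`, all radii `1 ≤ R ≤ R_v ≤ 1/(8μ)`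
with `A e^{−R} ≤ 1/2`, `12μ²R_v² ≤ 1/2`, and every radius assignment `ρ_j ∈ [R, R_v]`, the trial states
`Ψ_j(U) = χ_{ρ_j}(gnCoord μ U)·F_j(gnCoord μ U)` are physical, have `8c(1 − 12μ²R_v²)(1 − Ae^{−R}) ≤ ⟨Ψ_j,Ψ_j⟩ ≤ 8c`, satisfy the F6a floor with
tail `A e^{−ρ_j}`, and the uniform relative Gram bound with `ε = (12μ²R_v² + 2Ae^{−R})/((1 − 12μ²R_v²)(1 − Ae^{−R}))`. [cite: Luscher1983, §2–§3] -/
theorem trialStates_package (hF : IsEigenFamily K F) :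
    ∃ A Kq : ℝ, 0 ≤ A ∧ 0 ≤ Kq ∧
      ∀ B μ : ℝ, 0 < B → 0 < μ → B * μ ^ 3 = 1 / 4 → μ ≤ 1 / 8 → π ≤ B →
      ∀ R Rv : ℝ, 1 ≤ R → R ≤ Rv → Rv ≤ 1 / (8 * μ) → A * Real.exp (-R) ≤ 1 / 2 → 12 * μ ^ 2 * Rv ^ 2 ≤ 1 / 2 →
      ∀ ρ : Fin (K + 1) → ℝ, (∀ j, R ≤ ρ j ∧ ρ j ≤ Rv) →
        (∀ j : Fin (K + 1), IsPhys (fun U : Cfg => radialCutoff (ρ j) (gnCoord μ U) * F j (gnCoord μ U))) ∧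
        (∀ j : Fin (K + 1),
          8 * (μ ^ 9 * ((2 * π ^ 2)⁻¹) ^ 3) * ((1 - 12 * μ ^ 2 * Rv ^ 2) * (1 - A * Real.exp (-R))) ≤
            l2 (fun U : Cfg => radialCutoff (ρ j) (gnCoord μ U) * F j (gnCoord μ U))
              (fun U => radialCutoff (ρ j) (gnCoord μ U) * F j (gnCoord μ U)) ∧
          l2 (fun U : Cfg => radialCutoff (ρ j) (gnCoord μ U) * F j (gnCoord μ U))
              (fun U => radialCutoff (ρ j) (gnCoord μ U) * F j (gnCoord μ U)) ≤ 8 * (μ ^ 9 * ((2 * π ^ 2)⁻¹) ^ 3) ∧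
          0 < l2 (fun U : Cfg => radialCutoff (ρ j) (gnCoord μ U) * F j (gnCoord μ U))
              (fun U => radialCutoff (ρ j) (gnCoord μ U) * F j (gnCoord μ U))) ∧
        (∀ j : Fin (K + 1),
          linkC B ^ 3 * (1 - 2 * μ * (physLevel ((j : ℕ) + 1) + A * Real.exp (-ρ j)) - μ ^ 2 * Kq) *
              l2 (fun U : Cfg => radialCutoff (ρ j) (gnCoord μ U) * F j (gnCoord μ U))
                (fun U => radialCutoff (ρ j) (gnCoord μ U) * F j (gnCoord μ U)) ≤
            qform su2Rep B (fun U : Cfg => radialCutoff (ρ j) (gnCoord μ U) * F j (gnCoord μ U))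
              (fun U => radialCutoff (ρ j) (gnCoord μ U) * F j (gnCoord μ U))) ∧
        (∀ j j' : Fin (K + 1), j ≠ j' →
          |l2 (fun U : Cfg => radialCutoff (ρ j) (gnCoord μ U) * F j (gnCoord μ U))
              (fun U => radialCutoff (ρ j') (gnCoord μ U) * F j' (gnCoord μ U))| ≤
            (12 * μ ^ 2 * Rv ^ 2 + 2 * A * Real.exp (-R)) / ((1 - 12 * μ ^ 2 * Rv ^ 2) * (1 - A * Real.exp (-R))) *
              (Real.sqrt (l2 (fun U : Cfg => radialCutoff (ρ j) (gnCoord μ U) * F j (gnCoord μ U))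
                  (fun U => radialCutoff (ρ j) (gnCoord μ U) * F j (gnCoord μ U))) *
                Real.sqrt (l2 (fun U : Cfg => radialCutoff (ρ j') (gnCoord μ U) * F j' (gnCoord μ U))
                  (fun U => radialCutoff (ρ j') (gnCoord μ U) * F j' (gnCoord μ U))))) := by
  obtain ⟨A, Kq, Cf, hA0, hKq0, -, -, hpkg⟩ := oneSite_package hF
  refine ⟨A, Kq, hA0, hKq0, fun B μ hB hμ hBμ hμ8 hBπ R Rv hR1 hRRv hRvμ hAR hwin ρ hρ => ?_⟩
  have hc0 : 0 < μ ^ 9 * ((2 * π ^ 2)⁻¹) ^ 3 := by positivity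
  -- radius bookkeeping
  have hρ1 : ∀ j, 1 ≤ ρ j := fun j => hR1.trans (hρ j).1
  have hρμ : ∀ j, ρ j ≤ 1 / (8 * μ) := fun j => (hρ j).2.trans hRvμ
  have heρ : ∀ j, Real.exp (-ρ j) ≤ Real.exp (-R) := fun j => Real.exp_le_exp.mpr (neg_le_neg (hρ j).1)
  have hAρ : ∀ j, A * Real.exp (-ρ j) ≤ 1 / 2 := fun j => (mul_le_mul_of_nonneg_left (heρ j) hA0).trans hAR
  have hρwin : ∀ j, 12 * μ ^ 2 * ρ j ^ 2 ≤ 12 * μ ^ 2 * Rv ^ 2 := fun j =>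
    mul_le_mul_of_nonneg_left (pow_le_pow_left₀ (by linarith [hρ1 j]) (hρ j).2 2) (by positivity)
  -- the package at radius `ρ j`
  have hP : ∀ j, _ := fun j => hpkg B μ hB hμ hBμ hμ8 hBπ (ρ j) (hρ1 j) (hρμ j) (hAρ j) j
  -- uniform floor `8cD ≤ ⟨Ψ_j, Ψ_j⟩` and ceiling `≤ 8c`
  have hD1 : 0 < 1 - 12 * μ ^ 2 * Rv ^ 2 := by linarith
  have hD2 : 0 < 1 - A * Real.exp (-R) := by linarith
  have hD : 0 < (1 - 12 * μ ^ 2 * Rv ^ 2) * (1 - A * Real.exp (-R)) := mul_pos hD1 hD2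
  have hfloor : ∀ j, 8 * (μ ^ 9 * ((2 * π ^ 2)⁻¹) ^ 3) * ((1 - 12 * μ ^ 2 * Rv ^ 2) * (1 - A * Real.exp (-R))) ≤
      l2 (fun U : Cfg => radialCutoff (ρ j) (gnCoord μ U) * F j (gnCoord μ U))
        (fun U => radialCutoff (ρ j) (gnCoord μ U) * F j (gnCoord μ U)) := by
    intro j
    obtain ⟨-, -, hlo, -, hN, -, -⟩ := hP j
    -- `8c(1−12μ²ρ²)·N ≥ 8c(1−12μ²Rv²)(1−Ae^{−R})` since `N ≥ 1 − Ae^{−ρ} ≥ 1 − Ae^{−R}` and `1 − 12μ²ρ² ≥ 1 − 12μ²Rv² > 0`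
    have hN' : 1 - A * Real.exp (-R) ≤ ∫ y, (radialCutoff (ρ j) * F j) y ^ 2 := by
      have := mul_le_mul_of_nonneg_left (heρ j) hA0; linarith
    have hN0 : 0 ≤ ∫ y, (radialCutoff (ρ j) * F j) y ^ 2 := by linarith
    have h1 : (1 - 12 * μ ^ 2 * Rv ^ 2) * (1 - A * Real.exp (-R)) ≤ (1 - 12 * μ ^ 2 * ρ j ^ 2) * ∫ y, (radialCutoff (ρ j) * F j) y ^ 2 :=
      mul_le_mul (by linarith [hρwin j]) hN' hD2.le (by linarith [hρwin j])
    have h2 := mul_le_mul_of_nonneg_left h1 (by positivity : 0 ≤ 8 * (μ ^ 9 * ((2 * π ^ 2)⁻¹) ^ 3))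
    have e : 8 * (μ ^ 9 * ((2 * π ^ 2)⁻¹) ^ 3) * ((1 - 12 * μ ^ 2 * ρ j ^ 2) * ∫ y, (radialCutoff (ρ j) * F j) y ^ 2) =
        8 * (μ ^ 9 * ((2 * π ^ 2)⁻¹) ^ 3 * (1 - 12 * μ ^ 2 * ρ j ^ 2)) * ∫ y, (radialCutoff (ρ j) * F j) y ^ 2 := by ring
    rw [e] at h2
    exact h2.trans hlo
  have hceil : ∀ j, l2 (fun U : Cfg => radialCutoff (ρ j) (gnCoord μ U) * F j (gnCoord μ U))
      (fun U => radialCutoff (ρ j) (gnCoord μ U) * F j (gnCoord μ U)) ≤ 8 * (μ ^ 9 * ((2 * π ^ 2)⁻¹) ^ 3) := by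
    intro j
    obtain ⟨-, -, -, hhi, -, hN1, -⟩ := hP j
    exact hhi.trans (by nlinarith [hN1, hc0])
  have hF8 : 0 < 8 * (μ ^ 9 * ((2 * π ^ 2)⁻¹) ^ 3) * ((1 - 12 * μ ^ 2 * Rv ^ 2) * (1 - A * Real.exp (-R))) := by positivity
  refine ⟨fun j => (hP j).2.1, fun j => ⟨hfloor j, hceil j, hF8.trans_le (hfloor j)⟩, fun j => (hP j).1, fun j j' hjj' => ?_⟩
  -- the relative Gram bound: the package at outer radius `ρ j` and outer index `j'`, inner index `i := j`, inner radius `R' := ρ j'`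
  obtain ⟨-, -, -, -, -, -, hC⟩ := hpkg B μ hB hμ hBμ hμ8 hBπ (ρ j) (hρ1 j) (hρμ j) (hAρ j) j'
  have hZ := hC (ρ j') (hρ1 j') j hjj'
  have hmax : max (ρ j) (ρ j') ^ 2 ≤ Rv ^ 2 :=
    pow_le_pow_left₀ (le_trans (by linarith [hρ1 j]) (le_max_left _ _)) (max_le (hρ j).2 (hρ j').2) 2
  have hNum : 12 * μ ^ 2 * max (ρ j) (ρ j') ^ 2 + A * (Real.exp (-ρ j) + Real.exp (-ρ j')) ≤ 12 * μ ^ 2 * Rv ^ 2 + 2 * A * Real.exp (-R) := by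
    have h1 := mul_le_mul_of_nonneg_left hmax (by positivity : 0 ≤ 12 * μ ^ 2)
    have h2 : A * (Real.exp (-ρ j) + Real.exp (-ρ j')) ≤ A * (Real.exp (-R) + Real.exp (-R)) :=
      mul_le_mul_of_nonneg_left (add_le_add (heρ j) (heρ j')) hA0
    linarith
  have hZ' : |l2 (fun U : Cfg => radialCutoff (ρ j) (gnCoord μ U) * F j (gnCoord μ U))
      (fun U => radialCutoff (ρ j') (gnCoord μ U) * F j' (gnCoord μ U))| ≤
      8 * (μ ^ 9 * ((2 * π ^ 2)⁻¹) ^ 3) * (12 * μ ^ 2 * Rv ^ 2 + 2 * A * Real.exp (-R)) :=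
    hZ.trans (mul_le_mul_of_nonneg_left hNum (by positivity))
  have hNum0 : 0 ≤ 12 * μ ^ 2 * Rv ^ 2 + 2 * A * Real.exp (-R) := by positivity
  exact abs_le_ratio_mul_sqrt_mul_sqrt hc0 hD hNum0 hZ' (hfloor j) (hfloor j')

end Summit.QuantumFields.YangMills.Theorems.FemtoTransferGap.TransplantForms

end
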